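import Mathlib

/-!
HONEST FRAMING: exact (Metropolis-corrected) sampling algorithms for lattice gauge theory; figures
of merit are autocorrelation/cost numbers at stated couplings and volumes; no continuum-physics
claim.

# TiltedPiMeasure — two facts about exponentially tilted measures: finite PRODUCTS of tilts, and the
# `e^{2K}` transfer of nonnegative integrals under a tilt of oscillation `2K` (lean-2 GEN-12, toolkit)

Venture-side toolkit (OURS, folklore measure theory over Mathlib's `Measure.tilted`).  Cell `lqcd-flow`
(pub-lqcd), unit `pub-lqcd-lean-2-g12`, 2026-08-23.  Companion of GEN-11's binary-product lemma
`Scaling/SwapAcceptanceKernel.tilted_prod_tilted`; consumed by `TrivializingMaps/SpecificHeatCeilingTwoDim`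
(the two-dimensional specific-heat ceiling), where the punctured Wilson measure of `(ℤ/L)²` is pushed
forward to a product of one-plaquette tilted Haar measures.

* `pi_tilted_sum` — for probability measures `μ_i` and potentials `f_i` with `e^{f_i}` integrable,
  `(Measure.pi μ).tilted (ω ↦ Σ_i f_i(ω_i)) = Measure.pi (i ↦ (μ_i).tilted f_i)`: tilting a product by a
  sum of one-coordinate potentials keeps the coordinates independent;
* `integral_tilted_le_exp_osc_mul` — if `|h − c| ≤ K` then `∫ F d(μ.tilted h) ≤ e^{2K} ∫ F dμ` for
  every nonnegative integrable `F` (probability measure `μ`; the Literature's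
  `GibbsSpecificationTiltedRatio.integral_tilted_le_exp_mul` is the two-tilt version for `[0,1]`-valued
  observables — here one tilt, unbounded `F ≥ 0`).

(The push-forward rule `(μ.tilted (f ∘ Φ)).map Φ = (μ.map Φ).tilted f` is the Literature's
`Literature.Probability.LatticeModels.map_tilted_comp`, reused downstream, not restated.)
Nothing is cited as a fact; no `def`.
-/

noncomputable section

open MeasureTheory ProbabilityTheory Real Set

namespace Summit.Ventures.LatticeQCDFlow.Scaling

section Tilted

variable {α : Type*} [MeasurableSpace α]

/-- **A finite product of tilts is the tilt of the product by the sum of the one-coordinate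
potentials**: `(⨂ μ_i).tilted (ω ↦ Σ_i f_i(ω_i)) = ⨂ (μ_i.tilted f_i)` (probability measures `μ_i`,
`e^{f_i}` integrable). [folklore] -/
theorem pi_tilted_sum {ι : Type*} [Fintype ι] {X : ι → Type*} [∀ i, MeasurableSpace (X i)]
    (μ : ∀ i, Measure (X i)) [∀ i, IsProbabilityMeasure (μ i)] (f : ∀ i, X i → ℝ)
    (hfi : ∀ i, Integrable (fun x => exp (f i x)) (μ i)) :
    (Measure.pi μ).tilted (fun ω => ∑ i, f i (ω i)) = Measure.pi fun i => (μ i).tilted (f i) := by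
  classical
  haveI : ∀ i, IsProbabilityMeasure ((μ i).tilted (f i)) := fun i => isProbabilityMeasure_tilted (hfi i)
  have hZ : ∫ ω, exp (∑ i, f i (ω i)) ∂(Measure.pi μ) = ∏ i, ∫ x, exp (f i x) ∂(μ i) := by
    simp_rw [exp_sum]
    exact integral_fintype_prod_eq_prod (fun i x => exp (f i x))
  have hZi : ∀ i, 0 < ∫ x, exp (f i x) ∂(μ i) := fun i => integral_exp_pos (hfi i)
  symm
  refine Measure.pi_eq fun s hs => ?_
  rw [tilted_apply_eq_ofReal_integral' _ (MeasurableSet.univ_pi hs), ← integral_indicator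
    (MeasurableSet.univ_pi hs)]
  -- the indicator of a box of a product function is the product of the indicators
  have hind : ∀ ω : ∀ i, X i,
      (Set.univ.pi s).indicator (fun ω => exp (∑ i, f i (ω i)) / ∫ ω, exp (∑ i, f i (ω i)) ∂(Measure.pi μ)) ω
        = ∏ i, (s i).indicator (fun x => exp (f i x) / ∫ x, exp (f i x) ∂(μ i)) (ω i) := by
    intro ω
    by_cases hω : ω ∈ Set.univ.pi s
    · rw [Set.indicator_of_mem hω, hZ, exp_sum, ← Finset.prod_div_distrib]
      refine Finset.prod_congr rfl fun i _ => ?_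
      rw [Set.indicator_of_mem (hω i (Set.mem_univ i))]
    · rw [Set.indicator_of_notMem hω]
      simp only [Set.mem_univ_pi, not_forall] at hω
      obtain ⟨i, hi⟩ := hω
      exact (Finset.prod_eq_zero (Finset.mem_univ i) (Set.indicator_of_notMem hi _)).symm
  simp_rw [hind]
  rw [integral_fintype_prod_eq_prod
    (fun i x => (s i).indicator (fun x => exp (f i x) / ∫ x, exp (f i x) ∂(μ i)) x),
    ENNReal.ofReal_prod_of_nonneg fun i _ => integral_nonneg fun x =>
      Set.indicator_nonneg (fun y _ => div_nonneg (exp_pos _).le (hZi i).le) _]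
  refine Finset.prod_congr rfl fun i _ => ?_
  rw [tilted_apply_eq_ofReal_integral' _ (hs i), integral_indicator (hs i)]

/-- **A bounded-oscillation tilt changes nonnegative integrals by at most `e^{2K}`**: if `|h − c| ≤ K`
then `∫ F d(μ.tilted h) ≤ e^{2K} ∫ F dμ` for every nonnegative `μ`-integrable `F` (probability measure
`μ`). [folklore] -/
theorem integral_tilted_le_exp_osc_mul {μ : Measure α} [IsProbabilityMeasure μ] {h : α → ℝ}
    (hm : Measurable h) {c K : ℝ} (hb : ∀ x, |h x - c| ≤ K) {F : α → ℝ} (hF0 : ∀ x, 0 ≤ F x)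
    (hFi : Integrable F μ) :
    ∫ x, F x ∂(μ.tilted h) ≤ exp (2 * K) * ∫ x, F x ∂μ := by
  have hlo : ∀ x, c - K ≤ h x := fun x => by linarith [(abs_le.1 (hb x)).1]
  have hhi : ∀ x, h x ≤ c + K := fun x => by linarith [(abs_le.1 (hb x)).2]
  have hint : Integrable (fun x => exp (h x)) μ :=
    Integrable.of_bound hm.exp.aestronglyMeasurable (exp (c + K))
      (ae_of_all _ fun x => by
        rw [Real.norm_eq_abs, abs_of_pos (exp_pos _)]
        exact exp_le_exp.2 (hhi x))
  have hZ : exp (c - K) ≤ ∫ x, exp (h x) ∂μ := by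
    calc exp (c - K) = ∫ _x, exp (c - K) ∂μ := by simp
      _ ≤ ∫ x, exp (h x) ∂μ :=
        integral_mono (integrable_const _) hint fun x => exp_le_exp.2 (hlo x)
  have hZpos : 0 < ∫ x, exp (h x) ∂μ := (exp_pos _).trans_le hZ
  have hratio : ∀ x, exp (h x) / ∫ x, exp (h x) ∂μ ≤ exp (2 * K) := by
    intro x
    rw [div_le_iff₀ hZpos]
    calc exp (h x) ≤ exp (c + K) := exp_le_exp.2 (hhi x)
      _ = exp (2 * K) * exp (c - K) := by rw [← exp_add]; ring_nf
      _ ≤ exp (2 * K) * ∫ x, exp (h x) ∂μ := by gcongr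
  rw [integral_tilted, ← integral_const_mul]
  refine integral_mono_of_nonneg (ae_of_all _ fun x => ?_) (hFi.const_mul _)
    (ae_of_all _ fun x => ?_)
  · exact smul_nonneg (div_nonneg (exp_pos _).le hZpos.le) (hF0 x)
  · simp only [smul_eq_mul]
    exact mul_le_mul_of_nonneg_right (hratio x) (hF0 x)

end Tilted

end Summit.Ventures.LatticeQCDFlow.Scaling

end
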